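import Literature.NumberTheory.Automorphic.LevelActionNormalizingHecke
import Literature.NumberTheory.Automorphic.ArithmeticQuotientHeckeTwoLevel
import Literature.NumberTheory.Automorphic.ArithmeticQuotientTransfer
import HarnessLib

/-!
# Two-level Hecke operators, restriction and transfer in the coefficients-at-`p` model

Topic `NumberTheory/Automorphic`; namespace `Literature.NumberTheory.Automorphic.LevelAction`;
definitions with bodies and theorems, continuing `IntegralWeightHeckeModuleGL2` /
`LevelActionNormalizingHecke` (in universe `0`, as `ArithmeticQuotientTransfer`, whose transversal
lemmas are reused).  The level-changing maps of Hida theory for the sections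
`M(U, τ)` with coefficients carried by the level ([Hida1994AIF, §2: `res`, the trace and
`res ∘ tr = ∑_σ σ`]; [KhareThorne2017, §6.2 Lemma 6.5 (3), §6.3]), the `LevelAction` analogue of
`ArithmeticQuotientTransfer` / `ArithmeticQuotientHeckeTwoLevel`:

* `heckeOp₂ Δ θ U U' α = [U α U'] = ∑_{d ∈ UαU'/U'} act(d̃)` — the two-level double coset operator
  `M^{U'} → M^{U}` (`heckeOp₂_apply_mem`), independent of representatives
  (`heckeOp₂_apply_eq_sum_of_rep`); `heckeOp₂ U U α = heckeOp U α` (`heckeOp₂_self`);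
* `transferOp U U' = [U' 1 U] : M^U → M^{U'}` (`U ≤ U'` of finite index), with
  **`transferOp_apply_of_mem_invariants`: `tr (res m) = [U' : U] · m`** and, for `U ⊴ U'`,
  **`transferOp_apply_eq_sum_heckeOp`: `res (tr m) = ∑_{d ∈ U'/U} [U d̃ U] m`** (the norm of the
  `U'/U`-action);
* on cohomology: `resCohomology`, `trCohomology` and the same two identities
  (`trCohomology_resCohomology`, `resCohomology_trCohomology`).

## References

* H. Hida, Ann. Inst. Fourier 44 (1994), §2 (held). [Hida1994AIF]
* C. Khare, J. A. Thorne, Amer. J. Math. 139 (2017), §6.2–6.3 (arXiv:1409.7007, held). [KhareThorne2017]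
* G. Shimura, *Introduction to the Arithmetic Theory of Automorphic Functions* (1971), Ch. 3 §3.1. [ShimuraIATAF1971]
-/

noncomputable section

open CategoryTheory

namespace Literature.NumberTheory.Automorphic.LevelAction

/-! ### The two-level operator on an abstract `Δ`-module -/

section Abstract

variable {R : Type} [CommRing R] {𝒢 : Type} [Group 𝒢] {M : Type} [AddCommGroup M]
  [Module R M] (Δ : Submonoid 𝒢) (θ : Δ →* Module.End R M) (U U' : Subgroup 𝒢)

open scoped Classical in
/-- **`[U α U'] = ∑_{d ∈ UαU'/U'} act(d̃)`**, the two-level double coset operator (junk value `0` if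
`UαU'/U'` is infinite). [cite: ShimuraIATAF1971, Ch. 3 §3.1] [cite: KhareThorne2017, §6.2 Lemma 6.5 (3)] -/
def heckeOp₂ (α : 𝒢) : Module.End R M :=
  if h : (ArithmeticQuotient.doubleCosetQuot₂ U U' α).Finite then ∑ d ∈ h.toFinset, act Δ θ d.out else 0

variable {Δ θ U U'}

open scoped Classical in
/-- Unfolding lemma in the finite case. [folklore] -/
theorem heckeOp₂_eq_sum {α : 𝒢} (h : (ArithmeticQuotient.doubleCosetQuot₂ U U' α).Finite) :
    heckeOp₂ Δ θ U U' α = ∑ d ∈ h.toFinset, act Δ θ d.out := by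
  rw [heckeOp₂, dif_pos h]

/-- The junk value. [folklore] -/
theorem heckeOp₂_eq_zero_of_infinite {α : 𝒢} (h : ¬ (ArithmeticQuotient.doubleCosetQuot₂ U U' α).Finite) :
    heckeOp₂ Δ θ U U' α = 0 := by
  rw [heckeOp₂, dif_neg h]

variable (Δ θ U) in
/-- `[U α U] = heckeOp`. [folklore] -/
theorem heckeOp₂_self (α : 𝒢) : heckeOp₂ Δ θ U U α = heckeOp Δ θ U α := rfl

/-- Every coset in `UαU'/U'` is `(u α) U'` with `u ∈ U`. [folklore] -/
theorem exists_mk_eq_of_mem_doubleCosetQuot₂ {α : 𝒢} {d : 𝒢 ⧸ U'}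
    (hd : d ∈ ArithmeticQuotient.doubleCosetQuot₂ U U' α) : ∃ u ∈ U, ((u * α : 𝒢) : 𝒢 ⧸ U') = d := by
  obtain ⟨l, rfl⟩ := hd
  exact ⟨l, l.2, rfl⟩

/-- Representatives lie in `Δ` (`α ∈ Δ ⊇ U, U'`). [folklore] -/
theorem out_mem_of_mem_doubleCosetQuot₂ (hU : U.toSubmonoid ≤ Δ) (hU' : U'.toSubmonoid ≤ Δ) {α : 𝒢} (hα : α ∈ Δ)
    {d : 𝒢 ⧸ U'} (hd : d ∈ ArithmeticQuotient.doubleCosetQuot₂ U U' α) : d.out ∈ Δ := by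
  obtain ⟨u, hu, rfl⟩ := exists_mk_eq_of_mem_doubleCosetQuot₂ hd
  obtain ⟨u', hu'⟩ := QuotientGroup.mk_out_eq_mul U' (u * α)
  rw [hu']
  exact Δ.mul_mem (Δ.mul_mem (hU hu) hα) (hU' u'.2)

open scoped Classical in
/-- **`[U α U'] m = ∑_d act(y d) m` for any system of representatives `y` in `Δ`**, on `m ∈ M^{U'}`.
[cite: ShimuraIATAF1971, Ch. 3 §3.1] -/
theorem heckeOp₂_apply_eq_sum_of_rep (hU' : U'.toSubmonoid ≤ Δ) {α : 𝒢}
    (h : (ArithmeticQuotient.doubleCosetQuot₂ U U' α).Finite) {m : M} (hm : m ∈ invariants Δ θ U')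
    (y : 𝒢 ⧸ U' → 𝒢) (hy : ∀ d ∈ ArithmeticQuotient.doubleCosetQuot₂ U U' α, y d ∈ Δ)
    (hyd : ∀ d ∈ ArithmeticQuotient.doubleCosetQuot₂ U U' α, ((y d : 𝒢) : 𝒢 ⧸ U') = d) :
    heckeOp₂ Δ θ U U' α m = ∑ d ∈ h.toFinset, act Δ θ (y d) m := by
  rw [heckeOp₂_eq_sum h, LinearMap.sum_apply]
  refine Finset.sum_congr rfl fun d hd => ?_
  rw [Set.Finite.mem_toFinset] at hd
  exact act_out_apply_eq hU' hm (hy d hd) d (hyd d hd)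

open scoped Classical in
/-- **`[U α U']` maps `M^{U'}` into `M^{U}`** (`α ∈ Δ ⊇ U, U'`). [cite: ShimuraIATAF1971, Ch. 3 §3.1] -/
theorem heckeOp₂_apply_mem (hU : U.toSubmonoid ≤ Δ) (hU' : U'.toSubmonoid ≤ Δ) {α : 𝒢} (hα : α ∈ Δ) {m : M}
    (hm : m ∈ invariants Δ θ U') : heckeOp₂ Δ θ U U' α m ∈ invariants Δ θ U := by
  by_cases h : (ArithmeticQuotient.doubleCosetQuot₂ U U' α).Finite
  swap
  · rw [heckeOp₂_eq_zero_of_infinite h, LinearMap.zero_apply]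
    exact Submodule.zero_mem _
  intro v hv
  rw [heckeOp₂_eq_sum h, LinearMap.sum_apply, map_sum]
  have hterm : ∀ d ∈ h.toFinset, act Δ θ v (act Δ θ d.out m) = act Δ θ ((v : 𝒢) • d).out m := by
    intro d hd
    rw [Set.Finite.mem_toFinset] at hd
    have hdΔ : d.out ∈ Δ := out_mem_of_mem_doubleCosetQuot₂ hU hU' hα hd
    rw [← Module.End.mul_apply, ← act_mul (hU hv) hdΔ]
    refine (act_out_apply_eq hU' hm (Δ.mul_mem (hU hv) hdΔ) _ ?_).symm
    conv_rhs => rw [← QuotientGroup.out_eq' d]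
    rfl
  rw [Finset.sum_congr rfl hterm]
  exact ArithmeticQuotient.sum_doubleCosetQuot₂_coe_smul h ⟨v, hv⟩ fun d => act Δ θ d.out m

/-! #### The transfer `[U' 1 U] : M^U → M^{U'}` through a transversal -/

/-- **`[U' 1 U] m = ∑_{s ∈ S} act(s) m`** on `m ∈ M^U`, for a transversal `S` of `U'/U`
(`U ≤ U' ⊆ Δ`). [cite: Hida1994AIF, §2] -/
theorem heckeOp₂_one_apply_eq_sum (hU : U.toSubmonoid ≤ Δ) (hU' : U'.toSubmonoid ≤ Δ) (hle : U ≤ U')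
    {S : Finset 𝒢} (hS : Set.BijOn (fun s : 𝒢 => (s : 𝒢 ⧸ U)) S (ArithmeticQuotient.doubleCosetQuot₂ U' U 1))
    {m : M} (hm : m ∈ invariants Δ θ U) :
    heckeOp₂ Δ θ U' U 1 m = ∑ s ∈ S, act Δ θ s m := by
  classical
  have hfin : (ArithmeticQuotient.doubleCosetQuot₂ U' U (1 : 𝒢)).Finite := by
    rw [← hS.image_eq]
    exact S.finite_toSet.image _
  have hset : hfin.toFinset = S.image fun s : 𝒢 => (s : 𝒢 ⧸ U) :=
    Finset.coe_injective (by rw [Set.Finite.coe_toFinset, Finset.coe_image, hS.image_eq])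
  rw [heckeOp₂_eq_sum hfin, LinearMap.sum_apply, hset, Finset.sum_image fun s hs s' hs' h => hS.injOn hs hs' h]
  refine Finset.sum_congr rfl fun s hs => ?_
  have hsU' : s ∈ U' := ArithmeticQuotient.mem_of_bijOn hle hS hs
  exact act_out_apply_eq hU hm (hU' hsU') _ rfl

/-- **`tr ∘ res = [U' : U]`**: on `m ∈ M^{U'}`, `[U' 1 U] m = #S · m`. [cite: Hida1994AIF, §2] -/
theorem heckeOp₂_one_apply_of_mem_invariants (hU : U.toSubmonoid ≤ Δ) (hU' : U'.toSubmonoid ≤ Δ) (hle : U ≤ U')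
    {S : Finset 𝒢} (hS : Set.BijOn (fun s : 𝒢 => (s : 𝒢 ⧸ U)) S (ArithmeticQuotient.doubleCosetQuot₂ U' U 1))
    {m : M} (hm : m ∈ invariants Δ θ U') :
    heckeOp₂ Δ θ U' U 1 m = S.card • m := by
  rw [heckeOp₂_one_apply_eq_sum hU hU' hle hS (fun u hu => hm u (hle hu))]
  rw [Finset.sum_congr rfl fun s hs => hm s (ArithmeticQuotient.mem_of_bijOn hle hS hs), Finset.sum_const]

/-- **`res ∘ tr = ∑_{s ∈ S} [U s U]`** for `U ⊴ U'`: on `m ∈ M^U`, `[U' 1 U] m = ∑_{s ∈ S} [U s U] m`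
(the norm of the `U'/U`-action). [cite: Hida1994AIF, §2] -/
theorem heckeOp₂_one_apply_eq_sum_heckeOp (hU : U.toSubmonoid ≤ Δ) (hU' : U'.toSubmonoid ≤ Δ) (hle : U ≤ U')
    (hN : ∀ u' ∈ U', ∀ u ∈ U, u'⁻¹ * u * u' ∈ U)
    {S : Finset 𝒢} (hS : Set.BijOn (fun s : 𝒢 => (s : 𝒢 ⧸ U)) S (ArithmeticQuotient.doubleCosetQuot₂ U' U 1))
    {m : M} (hm : m ∈ invariants Δ θ U) :
    heckeOp₂ Δ θ U' U 1 m = ∑ s ∈ S, heckeOp Δ θ U s m := by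
  rw [heckeOp₂_one_apply_eq_sum hU hU' hle hS hm]
  refine Finset.sum_congr rfl fun s hs => ?_
  have hsU' : s ∈ U' := ArithmeticQuotient.mem_of_bijOn hle hS hs
  rw [heckeOp_apply_of_normalizing hU (hU' hsU') (hN s hsU') hm]

end Abstract

/-! ### Restriction and transfer on sections and on cohomology -/

section Cohomology

variable {R : Type} [CommRing R] {Γ 𝒢 : Type} [Group Γ] [Group 𝒢] (ι : Γ →* 𝒢) (Δ : Submonoid 𝒢)
  {V : Type} [AddCommGroup V] [Module R V] (τ : Δ →* Module.End R V) {U U' : Subgroup 𝒢}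
  (hU : U.toSubmonoid ≤ Δ) (hU' : U'.toSubmonoid ≤ Δ) (hle : U ≤ U')

/-- `M(U', τ) ⊆ M(U, τ)` for `U ≤ U'`. [folklore] -/
theorem sections_mono (hle : U ≤ U') : sections Δ τ U' ≤ sections Δ τ U := fun _ hf u hu => hf u (hle hu)

/-- Two-level operators commute with left translations. [folklore] -/
theorem heckeOp₂_leftTranslation (U U' : Subgroup 𝒢) (α : 𝒢) (γ : Γ) (f : 𝒢 → V) :
    heckeOp₂ Δ (fnAction Δ τ) U U' α (leftTranslation R ι V γ f) =
      leftTranslation R ι V γ (heckeOp₂ Δ (fnAction Δ τ) U U' α f) := by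
  classical
  by_cases h : (ArithmeticQuotient.doubleCosetQuot₂ U U' α).Finite
  · rw [heckeOp₂_eq_sum h, LinearMap.sum_apply, LinearMap.sum_apply, map_sum]
    exact Finset.sum_congr rfl fun d _ => act_leftTranslation ι Δ τ d.out γ f
  · rw [heckeOp₂_eq_zero_of_infinite h, LinearMap.zero_apply, LinearMap.zero_apply, map_zero]

/-- **`res : M(U', τ) → M(U, τ)`** as a morphism of `Γ`-representations. [cite: Hida1994AIF, §2] -/
def resRepHom (hle : U ≤ U') : Rep.of (rep ι Δ τ U') ⟶ Rep.of (rep ι Δ τ U) :=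
  Rep.ofHom ⟨Submodule.inclusion (sections_mono Δ τ hle), fun _ => LinearMap.ext fun _ => Subtype.ext rfl⟩

/-- Unfolding `resRepHom`. [folklore] -/
@[simp]
theorem resRepHom_hom_apply_coe (hle : U ≤ U') (f : sections Δ τ U') :
    ((resRepHom ι Δ τ hle).hom f : 𝒢 → V) = f := rfl

/-- **`tr = [U' 1 U] : M(U, τ) → M(U', τ)`** as a morphism of `Γ`-representations.
[cite: Hida1994AIF, §2] -/
def trRepHom : Rep.of (rep ι Δ τ U) ⟶ Rep.of (rep ι Δ τ U') :=
  Rep.ofHom ⟨(heckeOp₂ Δ (fnAction Δ τ) U' U 1).restrict fun _ hf =>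
      heckeOp₂_apply_mem hU' hU Δ.one_mem hf,
    fun γ => LinearMap.ext fun f => Subtype.ext (by
      simp only [LinearMap.coe_comp, Function.comp_apply, LinearMap.coe_restrict_apply, coe_rep_apply]
      exact heckeOp₂_leftTranslation ι Δ τ U' U 1 γ f)⟩

/-- Unfolding `trRepHom`. [folklore] -/
@[simp]
theorem trRepHom_hom_apply_coe (f : sections Δ τ U) :
    ((trRepHom ι Δ τ hU hU').hom f : 𝒢 → V) = heckeOp₂ Δ (fnAction Δ τ) U' U 1 f := rfl

/-- **`res : H^i(U', τ) → H^i(U, τ)`** (`U ≤ U'`). [cite: Hida1994AIF, §2] -/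
abbrev resCohomology (hle : U ≤ U') (i : ℕ) : cohomology ι Δ τ U' i ⟶ cohomology ι Δ τ U i :=
  groupCohomology.map (MonoidHom.id Γ) (resRepHom ι Δ τ hle) i

/-- **`tr : H^i(U, τ) → H^i(U', τ)`**, the transfer `[U' 1 U]`. [cite: Hida1994AIF, §2] -/
abbrev trCohomology (i : ℕ) : cohomology ι Δ τ U i ⟶ cohomology ι Δ τ U' i :=
  groupCohomology.map (MonoidHom.id Γ) (trRepHom ι Δ τ hU hU') i

/-- **`res ≫ tr = #S · 𝟙`** on `M(U', τ)`. [cite: Hida1994AIF, §2] -/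
theorem resRepHom_comp_trRepHom {S : Finset 𝒢}
    (hS : Set.BijOn (fun s : 𝒢 => (s : 𝒢 ⧸ U)) S (ArithmeticQuotient.doubleCosetQuot₂ U' U 1)) :
    resRepHom ι Δ τ hle ≫ trRepHom ι Δ τ hU hU' = S.card • 𝟙 _ :=
  Rep.hom_ext (Representation.IntertwiningMap.ext (LinearMap.ext fun f => by
    change (trRepHom ι Δ τ hU hU').hom ((resRepHom ι Δ τ hle).hom f) = S.card • f
    refine Subtype.ext ?_
    rw [trRepHom_hom_apply_coe, resRepHom_hom_apply_coe,
      heckeOp₂_one_apply_of_mem_invariants hU hU' hle hS f.2]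
    rfl))

/-- **`res (tr x) = #S · x`-type identity on cohomology: `tr ∘ res = #S`** on `H^i(U', τ)`.
[cite: Hida1994AIF, §2] -/
theorem trCohomology_resCohomology {S : Finset 𝒢}
    (hS : Set.BijOn (fun s : 𝒢 => (s : 𝒢 ⧸ U)) S (ArithmeticQuotient.doubleCosetQuot₂ U' U 1)) (i : ℕ) :
    resCohomology ι Δ τ hle i ≫ trCohomology ι Δ τ hU hU' i = S.card • 𝟙 _ := by
  rw [resCohomology, trCohomology, ← groupCohomology.map_id_comp, resRepHom_comp_trRepHom ι Δ τ hU hU' hle hS,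
    ArithmeticQuotient.map_id_nsmul, groupCohomology.map_id]

/-- **`tr ≫ res = ∑_{s ∈ S} [U s U]`** on `M(U, τ)`, for `U ⊴ U'`. [cite: Hida1994AIF, §2] -/
theorem trRepHom_comp_resRepHom (hN : ∀ u' ∈ U', ∀ u ∈ U, u'⁻¹ * u * u' ∈ U) {S : Finset 𝒢}
    (hS : Set.BijOn (fun s : 𝒢 => (s : 𝒢 ⧸ U)) S (ArithmeticQuotient.doubleCosetQuot₂ U' U 1)) :
    trRepHom ι Δ τ hU hU' ≫ resRepHom ι Δ τ hle =
      ∑ s ∈ S.attach, heckeRepHom ι Δ τ U hU (hU' (ArithmeticQuotient.mem_of_bijOn hle hS s.2)) :=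
  Rep.hom_ext (Representation.IntertwiningMap.ext (LinearMap.ext fun f => by
    change (resRepHom ι Δ τ hle).hom ((trRepHom ι Δ τ hU hU').hom f) = _
    refine Subtype.ext ?_
    rw [resRepHom_hom_apply_coe, trRepHom_hom_apply_coe,
      heckeOp₂_one_apply_eq_sum_heckeOp hU hU' hle hN hS f.2, ← Finset.sum_attach S, Rep.sum_hom,
      Representation.IntertwiningMap.toLinearMap_sum, LinearMap.sum_apply, AddSubmonoidClass.coe_finsetSum]
    rfl))

/-- **`res ∘ tr = ∑_{s ∈ S} [U s U]` on `H^i(U, τ)`** for `U ⊴ U'` (the norm of the `U'/U`-action by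
diamond-type operators). [cite: Hida1994AIF, §2] -/
theorem resCohomology_trCohomology (hN : ∀ u' ∈ U', ∀ u ∈ U, u'⁻¹ * u * u' ∈ U) {S : Finset 𝒢}
    (hS : Set.BijOn (fun s : 𝒢 => (s : 𝒢 ⧸ U)) S (ArithmeticQuotient.doubleCosetQuot₂ U' U 1)) (i : ℕ) :
    trCohomology ι Δ τ hU hU' i ≫ resCohomology ι Δ τ hle i =
      ∑ s ∈ S.attach, groupCohomology.map (MonoidHom.id Γ)
        (heckeRepHom ι Δ τ U hU (hU' (ArithmeticQuotient.mem_of_bijOn hle hS s.2))) i := by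
  rw [resCohomology, trCohomology, ← groupCohomology.map_id_comp, trRepHom_comp_resRepHom ι Δ τ hU hU' hle hN hS,
    ArithmeticQuotient.map_id_sum]

end Cohomology

end Literature.NumberTheory.Automorphic.LevelAction
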